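import Summits.RiemannHypothesis.RiemannHypothesis.Theorems.PfPersistenceAdmissibleClass

/-!
# PF persistence — single- and few-window classes as SET-LEVEL defs (pub-rhpf, barrier-typer gen 2)

**HONEST FRAMING. This is a long-odds MECHANISM SEARCH; no RH claims.** The cell's adjudicators asked for the CLASS
definitions behind three closed-by-density / member rows (ADJ-LOG rulings A3, A4, A9 (i)), as sets of `Datum`
(`PfPersistenceAdmissibleClass.lean`, re-typed `Window` with `ha : 0 < a`). All of them are determined by ONE or TWO
windows, hence inside the locality barrier's class (`FinitelyDetermined`, PROVED here by `finitelyDetermined_of_window` /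
a two-window variant); their per-window content is DATA (density closure, A11) and is not asserted here.

* §1 `𝒞_count` (A3): criteria of one window factoring through the eigen-count vector `(#{k : ε_k < τ})_{τ ∈ T}` for a
  finite threshold set `T` with `min T ≥ 10⁻⁴` — `eigCountBelow` (Courant–Fischer count, TYPED object), `countClassAt`.
* §2 `𝒞_proj` (A4): criteria of one window factoring through the bottom-`K` eigenspaces (`IsBottomSpace`, as a SET of
  subspaces so that degenerate clusters need no choice), `projectorClassAt`, `K ≤ 10`.
* §3 `L_k` (A9 (i)): criteria determined by at most `k` windows (`IsLk`); one-sided `a`-derivatives of a window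
  functional as FINITE DIFFERENCES over two windows `(a, N)`, `(a + h, N)` (`fdQuotient`, `fdClassAt`, PROVED `IsLk _ 2`) —
  the admissible reading of PF-I3 / PF-I4 (b) / TH1-EDGE-Q; a table constant indexed by `n` (e.g. `Λ(n)`) inside
  candidate code is NOT of this form (operator tier, ESCAPE-DOORS 'arithmetic-reading', A9 (ii)).
-/

set_option linter.dupNamespace false  -- the mandated namespace repeats `RiemannHypothesis`

noncomputable section

open Real Finset Matrix

namespace Summit.RiemannHypothesis.RiemannHypothesis.Theorems.PfPersistence

/-! ## §1 `𝒞_count` (RULING A3) -/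

/-- the number of form-eigenvalues of `M` below `τ` — Courant–Fischer COUNT: the largest dimension of a subspace on
which the form is `< τ·|v|²` (schema: `#{k : eps{k}_even < τ}`; TYPED object). [folklore] -/
def eigCountBelow {n : ℕ} (M : Matrix (Fin n) (Fin n) ℝ) (τ : ℝ) : ℕ :=
  sSup {k : ℕ | ∃ V : Submodule ℝ (Fin n → ℝ), Module.finrank ℝ V = k ∧
    ∀ v ∈ V, v ≠ 0 → v ⬝ᵥ (M *ᵥ v) < τ * (v ⬝ᵥ v)}

/-- `𝒞_count` at window `win` with finite threshold set `T`: membership is a function `Φ` of the count vector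
`τ ↦ eigCountBelow (d win) τ` on `T` only. [folklore] -/
def countClassAt (win : Window) (T : Finset ℝ) (Φ : (T → ℕ) → Prop) : Set Datum :=
  {d | Φ fun τ => eigCountBelow (d win) τ}

/-- the class `𝒞_count` (A3: one window, finite `T`, `min T ≥ 10⁻⁴` so that the counts are record-computable). [folklore] -/
def InCountClass (S : Set Datum) : Prop :=
  ∃ (win : Window) (T : Finset ℝ) (Φ : (T → ℕ) → Prop), (∀ τ ∈ T, (1 / 10 ^ 4 : ℝ) ≤ τ) ∧ S = countClassAt win T Φ

/-- PROVED: every `𝒞_count` member is finitely determined (one window) — inside the locality barrier's class. [folklore] -/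
theorem InCountClass.finitelyDetermined {S : Set Datum} (h : InCountClass S) : FinitelyDetermined S := by
  obtain ⟨win, T, Φ, -, rfl⟩ := h
  exact finitelyDetermined_of_window win fun M => Φ fun τ => eigCountBelow M τ

/-! ## §2 `𝒞_proj` (RULING A4) -/

/-- `V` is A BOTTOM-`K` SPACE of the form of `M`: `dim V = K` and every Rayleigh quotient on `V` is `≤` every Rayleigh
quotient on the `dotProduct`-orthogonal complement of `V` (a SET of subspaces: no choice at a degenerate cluster). [folklore] -/
def IsBottomSpace {n : ℕ} (M : Matrix (Fin n) (Fin n) ℝ) (K : ℕ) (V : Submodule ℝ (Fin n → ℝ)) : Prop :=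
  Module.finrank ℝ V = K ∧ ∀ v ∈ V, v ≠ 0 → ∀ u : Fin n → ℝ, u ≠ 0 → (∀ x ∈ V, x ⬝ᵥ u = 0) →
    v ⬝ᵥ (M *ᵥ v) / (v ⬝ᵥ v) ≤ u ⬝ᵥ (M *ᵥ u) / (u ⬝ᵥ u)

/-- `𝒞_proj` at window `win`, depth `K`: membership is a property `Φ` of the bottom-`K` spaces of `d win` (functionals
of the spectral projector onto the bottom-`K` eigenspace; schema tier `eigvec`, capture tables STRUCTURE-D3 §A). [folklore] -/
def projectorClassAt (win : Window) (K : ℕ) (Φ : Submodule ℝ (Fin (win.N + 1) → ℝ) → Prop) : Set Datum :=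
  {d | ∀ V, IsBottomSpace (d win) K V → Φ V}

/-- the class `𝒞_proj` (A4: one window, `K ≤ 10`). [folklore] -/
def InProjectorClass (S : Set Datum) : Prop :=
  ∃ (win : Window) (K : ℕ) (Φ : Submodule ℝ (Fin (win.N + 1) → ℝ) → Prop), K ≤ 10 ∧ S = projectorClassAt win K Φ

/-- PROVED: every `𝒞_proj` member is finitely determined (one window). [folklore] -/
theorem InProjectorClass.finitelyDetermined {S : Set Datum} (h : InProjectorClass S) : FinitelyDetermined S := by
  obtain ⟨win, K, Φ, -, rfl⟩ := h
  exact finitelyDetermined_of_window win fun M => ∀ V, IsBottomSpace M K V → Φ V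

/-! ## §3 `L_k` and finite differences in `a` (RULING A9 (i)) -/

/-- `L_k`: determined by at most `k` windows. [folklore] -/
def IsLk (S : Set Datum) (k : ℕ) : Prop :=
  ∃ W : Finset Window, W.card ≤ k ∧ ∀ d d' : Datum, (∀ win ∈ W, d win = d' win) → (d ∈ S ↔ d' ∈ S)

/-- PROVED: `L_k ⊆ τ_fin`. [folklore] -/
theorem IsLk.finitelyDetermined {S : Set Datum} {k : ℕ} (h : IsLk S k) : FinitelyDetermined S := by
  obtain ⟨W, -, hW⟩ := h
  exact ⟨W, hW⟩

/-- PROVED: `L_k ⊆ L_{k'}` for `k ≤ k'`. [folklore] -/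
theorem IsLk.mono {S : Set Datum} {k k' : ℕ} (h : IsLk S k) (hk : k ≤ k') : IsLk S k' := by
  obtain ⟨W, hW, h⟩ := h
  exact ⟨W, hW.trans hk, h⟩

/-- the window `h` above `win` at the same truncation (genuine: `a + h > 0` for `h ≥ 0`). [folklore] -/
def Window.stepUp (win : Window) (h : ℝ) (hh : 0 ≤ h) : Window :=
  ⟨win.a + h, win.N, add_pos_of_pos_of_nonneg win.ha hh⟩

/-- the truncation is unchanged by `stepUp`. [folklore] -/
@[simp] theorem Window.stepUp_N (win : Window) (h : ℝ) (hh : 0 ≤ h) : (win.stepUp h hh).N = win.N := rfl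

/-- the ONE-SIDED FINITE-DIFFERENCE QUOTIENT in `a` (step `h > 0`, fixed `N`) of a window functional `f` — the
admissible (`L₂`) reading of an `a`-derivative (A9 (i)); `f` reads one window's matrix (any tier ≤ coupling). [folklore] -/
def fdQuotient (f : (win : Window) → Matrix (Fin (win.N + 1)) (Fin (win.N + 1)) ℝ → ℝ) (win : Window) (h : ℝ)
    (hh : 0 < h) (d : Datum) : ℝ :=
  (f (win.stepUp h hh.le) (d (win.stepUp h hh.le)) - f win (d win)) / h

/-- the two-window class "`Φ` holds of the finite-difference quotient of `f` at `win` with step `h`" (PF-I3 kink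
readings, PF-I4 (b) `D_h`, TH1-EDGE-Q quotients with `θ_N` read at the same window). [folklore] -/
def fdClassAt (f : (win : Window) → Matrix (Fin (win.N + 1)) (Fin (win.N + 1)) ℝ → ℝ) (win : Window) (h : ℝ)
    (hh : 0 < h) (Φ : ℝ → Prop) : Set Datum :=
  {d | Φ (fdQuotient f win h hh d)}

/-- PROVED: finite-difference classes are `L₂` (hence closed for GLOBAL separation by the locality barrier). [folklore] -/
theorem isLk_fdClassAt (f : (win : Window) → Matrix (Fin (win.N + 1)) (Fin (win.N + 1)) ℝ → ℝ) (win : Window)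
    (h : ℝ) (hh : 0 < h) (Φ : ℝ → Prop) : IsLk (fdClassAt f win h hh Φ) 2 := by
  classical
  refine ⟨{win, win.stepUp h hh.le}, Finset.card_le_two, fun d d' hdd' => ?_⟩
  have h1 : d win = d' win := hdd' win (by simp)
  have h2 : d (win.stepUp h hh.le) = d' (win.stepUp h hh.le) := hdd' _ (by simp)
  simp only [fdClassAt, fdQuotient, Set.mem_setOf_eq, h1, h2]

end Summit.RiemannHypothesis.RiemannHypothesis.Theorems.PfPersistence

end
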